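import Summits.AtomisticToContinuum.HydrodynamicLimit.Theses.LambertianContactSwap
import Summits.AtomisticToContinuum.HydrodynamicLimit.Theorems.JParityClosureCollisionTightnessDomination
import Summits.AtomisticToContinuum.HydrodynamicLimit.Theorems.SuperextensiveClosureCostTransferInequalityTools
import Literature.Analysis.FluidPDE.HardSphereFlowMeasurable
import Literature.MathematicalPhysics.KineticTheory.HardSphereEulerProofs
import HarnessLib

/-!
# Stub `stub_domination` of the line `Sketch` of the crux `ContactAngleEquidistribution`
# (stmt-AtomisticToContinuum-12097, route LambertianContactSwap)

Registered stub of the lead skeleton `Cruxes/ContactAngleEquidistribution/Lines/Sketch.lean`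
(namespace `…Cruxes.ContactAngleEquidistribution.Sketch`); the signature below is VERBATIM the registered
one.

**Statement.** For continuous profiles `a₀, θ₀ > 0`, `u₀` on `𝕋³` and a reference temperature `θe`
with `θ₀(x) < θe` for EVERY `x`, with `σ₀ = 1/2`: for every reduced density `0 < σ < σ₀` there is
`C` such that for all `N` and every hard-sphere flow `Φ` the local Gibbs law is dominated, as a
measure (Mathlib order `μ ≤ ν ↔ ∀ s, μ s ≤ ν s`), by `e^{C(N+1)}` times the homogeneous Gibbs law
at temperature `θe`:
`localGibbsLaw σ a₀ u₀ θ₀ N Φ ≤ e^{C(N+1)} • localGibbsLaw σ 1 0 θe N Φ`.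

**Proof outline.** Both laws are the flow-free local Gibbs measures (`localGibbsLaw_eq`),
`volume.withDensity (ofReal ∘ canonicalDensity …)`. The one-body profiles are
`f(x,v) = a₀(x) M_{1,u₀(x),θ₀(x)}(v)` and `g(v) = M_{1,0,θe}(v)`; with `Θ = max θ₀ < θe` (attained
on the compact torus) completing the square (`exponent_bound_lt`:
`−s²/(2Θ) + (s+r)²/(2θe) ≤ r²/(2(θe − Θ))`, `s = ‖v − u₀(x)‖`, `r = ‖u₀(x)‖`) gives the POINTWISE
one-body domination `f ≤ K g` with
`K = (A+1) (2πϑ)^{-3/2} e^{U²/(2(θe−Θ))} (2πθe)^{3/2}` (`exists_localGibbsProfile_le_const_of_lt`;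
`A ≥ a₀ ≥ a > 0`, `ϑ ≤ θ₀`, `‖u₀‖ ≤ U` from `exists_profile_bounds`). The tree lemma
`canonicalDensity_le_const_mul` (file `JParityClosureCollisionTightnessDomination`) turns this into
the pointwise domination of the canonical densities `ρ_LG ≤ (K/a)^{N+1} ρ_G` for `σ ≤ 1/2`
(`Z_LG ≥ a^{N+1} Z_G`, `Z_G > 0`), and `(K/a)^{N+1} ≤ e^{(K/a)(N+1)}`
(`TransferBudget.pow_le_exp_mul`); `withDensity_mono` + `withDensity_smul'` give the measure
inequality with `C = K/a` (independent of `σ`).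

References: C. Kipnis, C. Landim, *Scaling Limits of Interacting Particle Systems* (1999), App. 1 §8
(entropy and density bounds between a local equilibrium and the invariant state); H. Spohn, *Large
Scale Dynamics of Interacting Particles* (1991), Part I §2.3.
-/

noncomputable section

open MeasureTheory Filter Set Topology ProbabilityTheory
open scoped ENNReal BigOperators Classical

namespace Summit.AtomisticToContinuum.HydrodynamicLimit.Theorems.ContactAngleEquidistributionSketch

open Literature.Analysis.FluidPDE Literature.MathematicalPhysics.KineticTheory
open Summit.AtomisticToContinuum.HydrodynamicLimit.Theses.LambertianContactSwap

/-! ### Completing the square at a strictly larger temperature -/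

/-- The square-completion inequality behind the pointwise domination: for `0 < Θ < θe` and real
`s, r`, `−s²/(2Θ) + (s + r)²/(2θe) ≤ r²/(2(θe − Θ))`; indeed the difference is
`(Θ r − (θe − Θ) s)² / (2 Θ θe (θe − Θ)) ≥ 0`. [folklore] -/
theorem exponent_bound_lt {Θ θe s r : ℝ} (hΘ : 0 < Θ) (hlt : Θ < θe) :
    -s ^ 2 / (2 * Θ) + (s + r) ^ 2 / (2 * θe) ≤ r ^ 2 / (2 * (θe - Θ)) := by
  have hθe : 0 < θe := hΘ.trans hlt
  have hδ : 0 < θe - Θ := sub_pos.2 hlt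
  have key : r ^ 2 / (2 * (θe - Θ)) - (-s ^ 2 / (2 * Θ) + (s + r) ^ 2 / (2 * θe)) =
      (Θ * r - (θe - Θ) * s) ^ 2 / (2 * Θ * θe * (θe - Θ)) := by
    field_simp
    ring
  have hsq : 0 ≤ (Θ * r - (θe - Θ) * s) ^ 2 / (2 * Θ * θe * (θe - Θ)) := by positivity
  linarith

variable {a₀ θ₀ : T3 → ℝ} {u₀ : T3 → V3}

/-- **Gaussian domination of the one-body local Gibbs profile at any strictly larger temperature.**
If `0 ≤ a₀ ≤ A`, `0 < ϑ ≤ θ₀ ≤ Θ`, `‖u₀‖ ≤ U` and `Θ < θe`, then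
`a₀(x) M_{1,u₀(x),θ₀(x)}(v) ≤ C · M_{1,0,θe}(v)` for an explicit constant `C > 0`
(prefactor `≤ (2πϑ)^{-d/2}`, exponent by `exponent_bound_lt`:
`−‖v−u‖²/(2θ₀) + ‖v‖²/(2θe) ≤ U²/(2(θe − Θ))`). [folklore] -/
theorem exists_localGibbsProfile_le_const_of_lt {A Θ ϑ U θe : ℝ} (ha0 : ∀ x, 0 ≤ a₀ x)
    (hA : ∀ x, a₀ x ≤ A) (hϑ0 : 0 < ϑ) (hϑ : ∀ x, ϑ ≤ θ₀ x) (hΘ : ∀ x, θ₀ x ≤ Θ)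
    (hU : ∀ x, ‖u₀ x‖ ≤ U) (hlt : Θ < θe) :
    ∃ C : ℝ, 0 < C ∧ ∀ y : T3 × V3,
      localGibbsProfile a₀ u₀ θ₀ y ≤
        C * localGibbsProfile (fun _ => 1) (fun _ => (0 : V3)) (fun _ => θe) y := by
  have hΘ0 : 0 < Θ := hϑ0.trans_le ((hϑ 0).trans (hΘ 0))
  have hθe : 0 < θe := hΘ0.trans hlt
  have hδ : 0 < θe - Θ := sub_pos.2 hlt
  set d : ℝ := (Module.finrank ℝ V3 : ℝ) with hd
  have hd0 : 0 ≤ d := by rw [hd]; exact_mod_cast Nat.zero_le _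
  set c₁ : ℝ := (2 * Real.pi * ϑ) ^ (-d / 2) with hc₁
  set c₂ : ℝ := (2 * Real.pi * θe) ^ (-d / 2) with hc₂
  have hc₁0 : 0 < c₁ := Real.rpow_pos_of_pos (by positivity) _
  have hc₂0 : 0 < c₂ := Real.rpow_pos_of_pos (by positivity) _
  have hA0 : 0 ≤ A := (ha0 0).trans (hA 0)
  set E₀ : ℝ := Real.exp (U ^ 2 / (2 * (θe - Θ))) with hE₀
  have hE₀0 : 0 < E₀ := Real.exp_pos _
  refine ⟨(A + 1) * c₁ * E₀ / c₂, by positivity, fun y => ?_⟩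
  obtain ⟨x, v⟩ := y
  have hθx : 0 < θ₀ x := hϑ0.trans_le (hϑ x)
  -- the three factors of the local Gibbs profile
  have hpre : (2 * Real.pi * θ₀ x) ^ (-d / 2) ≤ c₁ :=
    Real.rpow_le_rpow_of_nonpos (by positivity) (by nlinarith [hϑ x, Real.pi_pos])
      (by linarith)
  have hexp : Real.exp (-‖v - u₀ x‖ ^ 2 / (2 * θ₀ x)) ≤
      E₀ * Real.exp (-‖v - 0‖ ^ 2 / (2 * θe)) := by
    rw [hE₀, ← Real.exp_add, sub_zero]
    refine Real.exp_le_exp.2 ?_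
    have hv : ‖v‖ ≤ ‖v - u₀ x‖ + ‖u₀ x‖ := by
      calc ‖v‖ = ‖(v - u₀ x) + u₀ x‖ := by rw [sub_add_cancel]
        _ ≤ ‖v - u₀ x‖ + ‖u₀ x‖ := norm_add_le _ _
    have hv2 : ‖v‖ ^ 2 ≤ (‖v - u₀ x‖ + ‖u₀ x‖) ^ 2 := pow_le_pow_left₀ (norm_nonneg v) hv 2
    have h1 : -‖v - u₀ x‖ ^ 2 / (2 * θ₀ x) ≤ -‖v - u₀ x‖ ^ 2 / (2 * Θ) := by
      rw [neg_div, neg_div, neg_le_neg_iff]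
      exact div_le_div_of_nonneg_left (sq_nonneg _) (by positivity) (by linarith [hΘ x])
    have h2 := exponent_bound_lt (s := ‖v - u₀ x‖) (r := ‖u₀ x‖) hΘ0 hlt
    have hr2 : ‖u₀ x‖ ^ 2 ≤ U ^ 2 := pow_le_pow_left₀ (norm_nonneg _) (hU x) 2
    have h3 : ‖u₀ x‖ ^ 2 / (2 * (θe - Θ)) ≤ U ^ 2 / (2 * (θe - Θ)) :=
      div_le_div_of_nonneg_right hr2 (by positivity)
    have h4 : ‖v‖ ^ 2 / (2 * θe) ≤ (‖v - u₀ x‖ + ‖u₀ x‖) ^ 2 / (2 * θe) :=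
      div_le_div_of_nonneg_right hv2 (by positivity)
    have h5 : -‖v‖ ^ 2 / (2 * θe) = -(‖v‖ ^ 2 / (2 * θe)) := by ring
    have h6 : -‖v - u₀ x‖ ^ 2 / (2 * Θ) = -(‖v - u₀ x‖ ^ 2 / (2 * Θ)) := by ring
    rw [h6] at h1 h2
    linarith
  have hax : a₀ x ≤ A + 1 := (hA x).trans (by linarith)
  have hQ : localGibbsProfile (fun _ => 1) (fun _ => (0 : V3)) (fun _ => θe) (x, v) =
      c₂ * Real.exp (-‖v - 0‖ ^ 2 / (2 * θe)) := by
    simp only [localGibbsProfile, localMaxwellian, one_mul, hc₂]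
    rfl
  calc localGibbsProfile a₀ u₀ θ₀ (x, v)
      = a₀ x * ((2 * Real.pi * θ₀ x) ^ (-d / 2) * Real.exp (-‖v - u₀ x‖ ^ 2 / (2 * θ₀ x))) := by
        simp only [localGibbsProfile, localMaxwellian, one_mul]
        rfl
    _ ≤ (A + 1) * (c₁ * (E₀ * Real.exp (-‖v - 0‖ ^ 2 / (2 * θe)))) := by
        refine mul_le_mul hax ?_ (by positivity) (by positivity)
        exact mul_le_mul hpre hexp (by positivity) hc₁0.le
    _ = (A + 1) * c₁ * E₀ / c₂ *
          localGibbsProfile (fun _ => 1) (fun _ => (0 : V3)) (fun _ => θe) (x, v) := by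
        rw [hQ]
        field_simp

/-! ### Domination of the local Gibbs measure at any temperature above `sup θ₀` -/

/-- **Pointwise domination of the local Gibbs measure by the homogeneous Gibbs measure at any
temperature `θe > sup θ₀`.** For continuous profiles `a₀, θ₀ > 0`, `u₀` with `θ₀(x) < θe` for all
`x` there is `C` such that for every `σ ≤ 1/2` and every `N`,
`localGibbsMeasure σ a₀ u₀ θ₀ N ≤ e^{C(N+1)} • localGibbsMeasure σ 1 0 θe N`: the one-body bound
`f ≤ K g` (`exists_localGibbsProfile_le_const_of_lt`, `Θ = max θ₀ < θe` attained on the compact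
torus) gives `ρ_LG ≤ (K/a)^{N+1} ρ_G` (`canonicalDensity_le_const_mul`), `(K/a)^{N+1} ≤ e^{(K/a)(N+1)}`,
and `withDensity_mono`. [cite: KipnisLandim1999, App. 1 §8] -/
theorem exists_localGibbsMeasure_le_exp_smul (ha : Continuous a₀) (hθ : Continuous θ₀)
    (hu : Continuous u₀) (ha0 : ∀ x, 0 < a₀ x) (hθ0 : ∀ x, 0 < θ₀ x) {θe : ℝ}
    (hθe : ∀ x, θ₀ x < θe) :
    ∃ C : ℝ, 0 ≤ C ∧ ∀ σ : ℝ, σ ≤ 1 / 2 → ∀ N : ℕ,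
      localGibbsMeasure σ a₀ u₀ θ₀ N ≤
        ENNReal.ofReal (Real.exp (C * ((N : ℝ) + 1))) •
          localGibbsMeasure σ (fun _ => 1) (fun _ => (0 : V3)) (fun _ => θe) N := by
  obtain ⟨A, a, -, ϑ, U, ha_pos, hϑ0, -, hA, haa, -, hϑ, hU⟩ :=
    exists_profile_bounds ha hθ hu ha0 hθ0
  obtain ⟨xM, -, hxM⟩ := isCompact_univ.exists_isMaxOn univ_nonempty hθ.continuousOn
  have hΘ : ∀ x, θ₀ x ≤ θ₀ xM := fun x => (isMaxOn_iff.1 hxM) x (mem_univ x)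
  have hlt : θ₀ xM < θe := hθe xM
  have hθe0 : 0 < θe := (hθ0 xM).trans hlt
  obtain ⟨K, hK0, hK⟩ :=
    exists_localGibbsProfile_le_const_of_lt (fun x => (ha0 x).le) hA hϑ0 hϑ hΘ hU hlt
  have hKa : 0 ≤ K / a := by positivity
  refine ⟨K / a, hKa, fun σ hσ N => ?_⟩
  have hfQ0 : 0 ≤ localGibbsProfile (fun _ => 1) (fun _ => (0 : V3)) (fun _ => θe) :=
    fun y => localGibbsProfile_nonneg (fun _ => zero_le_one) (fun _ => hθe0.le) y
  have hexp : (K / a) ^ (N + 1) ≤ Real.exp (K / a * ((N : ℝ) + 1)) := by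
    have := TransferBudget.pow_le_exp_mul hKa (N + 1)
    push_cast at this
    exact this
  have hpt : ∀ z : Config (N + 1) (Fin 3) T3,
      canonicalDensity (Torus.geometry (Fin 3)) (hsDiameter σ N) (N + 1)
          (localGibbsProfile a₀ u₀ θ₀) z ≤
        Real.exp (K / a * ((N : ℝ) + 1)) *
          canonicalDensity (Torus.geometry (Fin 3)) (hsDiameter σ N) (N + 1)
            (localGibbsProfile (fun _ => 1) (fun _ => (0 : V3)) (fun _ => θe)) z := fun z =>
    (canonicalDensity_le_const_mul ha hθ hu ha0 hθ0 ha_pos haa hθe0 hK hσ N z).trans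
      (mul_le_mul_of_nonneg_right hexp (canonicalDensity_nonneg' hfQ0 _ _ z))
  unfold localGibbsMeasure
  rw [← withDensity_smul' _ _ ENNReal.ofReal_ne_top]
  refine withDensity_mono (Eventually.of_forall fun z => ?_)
  simp only [Pi.smul_apply, smul_eq_mul]
  rw [← ENNReal.ofReal_mul (by positivity)]
  exact ENNReal.ofReal_le_ofReal (hpt z)

/-- STUB `domination` of line `Sketch` (crux ContactAngleEquidistribution, stmt-AtomisticToContinuum-12097): the local Gibbs law is dominated, as a measure, by `e^{C(N+1)}` times the homogeneous Gibbs law at a temperature `θe > sup θ₀` (pointwise form of the `L²` transfer budget: density ratio `Z_LG⁻¹ Z_G ∏ᵢ a₀ M_{u₀,θ₀}/M_{0,θe} ≤ (K/a)^{N+1}`; `σ₀ = 1/2`, the laws do not depend on the flow, `localGibbsLaw_eq`, and `exists_localGibbsMeasure_le_exp_smul`). [cite: KipnisLandim1999, App. 1 §8] -/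
theorem stub_domination :
    ∀ (a₀ θ₀ : T3 → ℝ) (u₀ : T3 → V3), Continuous a₀ → Continuous θ₀ → Continuous u₀ →
      (∀ x, 0 < a₀ x) → (∀ x, 0 < θ₀ x) → ∀ θe : ℝ, (∀ x, θ₀ x < θe) →
      ∃ σ₀ : ℝ, 0 < σ₀ ∧ ∀ σ : ℝ, 0 < σ → σ < σ₀ → ∃ C : ℝ, ∀ (N : ℕ)
        (Φ : HardSphereFlow (Torus.geometry (Fin 3)) (hsDiameter σ N) (N + 1)),
        localGibbsLaw σ a₀ u₀ θ₀ N Φ ≤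
          ENNReal.ofReal (Real.exp (C * ((N : ℝ) + 1))) •
            localGibbsLaw σ (fun _ => 1) (fun _ => 0) (fun _ => θe) N Φ := by
  intro a₀ θ₀ u₀ ha hθ hu ha0 hθ0 θe hθe
  obtain ⟨C, -, hC⟩ := exists_localGibbsMeasure_le_exp_smul ha hθ hu ha0 hθ0 hθe
  refine ⟨1 / 2, by norm_num, fun σ _ hσ => ⟨C, fun N Φ => ?_⟩⟩
  rw [localGibbsLaw_eq, localGibbsLaw_eq]
  exact hC σ hσ.le N

end Summit.AtomisticToContinuum.HydrodynamicLimit.Theorems.ContactAngleEquidistributionSketch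

end
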